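import Summits.BirchSwinnertonDyer.BirchSwinnertonDyer.Theorems.SignedLowerHalvesSprungLowerDivisibilityAtThreeCokerBoundByMassKeying
import Summits.BirchSwinnertonDyer.BirchSwinnertonDyer.Theorems.SignedLowerHalvesSprungLowerDivisibilityAtThreeCokerBoundByMassMatar
import Literature.NumberTheory.EllipticCurves.Sprung2012.SharpFlatPoitouTateFunctionalModel
import Literature.NumberTheory.EllipticCurves.SupersingularIrreducibleProofs
import Literature.NumberTheory.EllipticCurves.TateModuleContinuityProofs
import HarnessLib

/-!
# Crux `SprungLowerDivisibilityAtThree` (item stmt-BirchSwinnertonDyer-19875; x8 children 22569 / 22901 / 22570 / 23112),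
# line `chromatic-common-zeros`: «F-α♮ BY MASS», part 5 — the Poitou–Tate input TYPED and CONSUMED: (M1) «chromatic excess
# ≤ cotorsion» and the REGISTERED STUB F-α♮ `IotaDoor.stub_cokerBoundIotaOffT` modulo NAMED PRINTED FACTS ONLY

Cell `bsd-ssimc` (host), width seat `cruxlead-stmt-BirchSwinnertonDyer-19875-w3` (gen 9) under the 19875 LEAD; `--supports`
stmt-BirchSwinnertonDyer-22569 `--as helper`; theorems only (no `def`, no named fact, no instance); closes NO item. Companion of
w2 g9's four files `…CokerBoundByMass` (p665043: stub ⟸ (MASS♮) ⟸ (M1) ∧ (M2)), `…CokerBoundByMassSkeleton` (p665510: the module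
algebra of (M1)), `…CokerBoundByMassMatar` (p665840: (M2) by name from Matar 2020; `cokerBoundIotaOffT_of_cotorsion_of_matar (hM1)`),
`…CokerBoundByMassKeying` ((M1) keying-immune; `min_lengthAt_le_fine_add_torsion_of_poitouTate_functionalModel` = (M1) at one prime
from a Poitou–Tate datum in the functional model — «the exact shape the typer has to instantiate»). THIS FILE instantiates it with
the named construction fact `Sprung2012.thm714seq_sharpFlat_poitouTate_functionalModel` (this seat, Literature, p666901: Sprung 2012
Thm. 7.14 proof p. 1504, (7.18)_∞ and (3) = Kobayashi 2003 (7.16)–(7.20) / Thm. 7.3 i), in the functional model of `H¹_Iw(ℚ_p,T)`,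
NATURAL keying: `loc : 𝐇¹ → P` injective, `toX : P → X` exact, `X ↠ X⁰` with kernel `range toX`, `X ↠ X^•` with kernel
`toX(Ker Col^•)`), Kato's Thm. 12.4 (3) (`Kato2004.thm12_4`: `𝐇¹` free of rank one — `E[p]` is irreducible at a supersingular
`p`, tree theorem `hasIrreducibleModPGaloisRep_of_dvd_frobeniusTrace`) and the construction fact `Kato2004.nonempty_iwasawaH1Data`.

HONEST FRAMING: CONDITIONAL on five NAMED facts, all transcriptions of published theorems — `thm714seq_sharpFlat_poitouTate_functionalModel`
(Sprung 2012 / Kobayashi 2003 / Kato 2004), `Kato2004.thm12_4`, `Kato2004.nonempty_iwasawaH1Data`, and (for §3) w2's two: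
`matar2020_thm11_selmerDualTorsion_pseudoIso_fineSelmerDual`, `Kato2004_fineSelmerDual_isTorsion` — and on NOTHING displayed. Nothing
about any curve's Selmer group is computed; K_spor, S4b-cyc, the residue R♮, K1, leaf X8 and BSD are NOT proved by anything here.
KEYING: the Poitou–Tate fact is natural-keyed (`γ⁻¹` duals against the covariant `𝐇¹` and `P`); the registered stub speaks of the
tree's `γ`-keyed objects; the bridge is w2's `massCotorsion_of_contraFamily` (read (M1) at the mirror prime `ι𝔭`) — no `γ`-keyed
twin of a printed fact is used anywhere in the chain (cf. the HOLD on the parent crux, director (266)).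

* §1 `massCotorsion_contraFamily_of_poitouTate` — (M1) for the `γ⁻¹`-keyed (print-keyed) family of pinned duals on class X8, at
  every height-one `𝔭 ∌ p, T`: `min(ℓ_𝔭 X♯, ℓ_𝔭 X♭) ≤ ℓ_𝔭 X⁰ + ℓ_𝔭 tors_Λ X(E/ℚ_∞)`.
* §2 `massCotorsion_of_poitouTate` — the same for the `γ`-keyed family = hypothesis `hM1` of `cokerBoundIotaOffT_of_cotorsion_of_matar`
  VERBATIM.
* §3 `cokerBoundIotaOffT_of_poitouTate` — THE REGISTERED STUB SIGNATURE of `IotaDoor.stub_cokerBoundIotaOffT` (children 22569 / 22901 /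
  22570 / 23112), no displayed hypothesis, modulo the five named facts.

References: [Sprung2012] Thm. 7.14 with (3) and Def. 7.13 (p. 1504), Def. 7.9 / 7.11 (p. 1503), Props. 7.3/7.6, Prop. 6.14; [Kobayashi2003]
(7.16)–(7.20), Prop. 7.1, Thm. 7.3 (pp. 12–13), Thm. 5.1 iii); [Kato2004Asterisque] §12.2, Thm. 12.4 (pp. 220–221), (17.13.1) (p. 279);
[KuriharaPollack2007] Prop. 1.2; [LeiSujatha2021] (SES-KP), (PT); [Wingberg1989] Cor. 2.5; [Matar2020] Thm. 1.1; [Serre1972] §1.11;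
tree: w2 g9's four companions, `Sprung2012/SharpFlatPoitouTateFunctionalModel`, `Kato2004/IwasawaCohomology`, `SupersingularIrreducibleProofs`,
`TateModuleContinuityProofs`.
-/

set_option linter.dupNamespace false
set_option autoImplicit false

noncomputable section

open scoped Classical NumberField MatrixGroups ModularForm

open NumberField IsDedekindDomain CongruenceSubgroup WeierstrassCurve Field
  Literature.NumberTheory.EllipticCurves Literature.NumberTheory.EllipticCurves.ModularForms
  Literature.NumberTheory.EllipticCurves.ZpExtension Literature.NumberTheory.EllipticCurves.Sprung2017
  Literature.NumberTheory.EllipticCurves.Sprung2012 Literature.NumberTheory.EllipticCurves.Rank1Residual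
  Literature.NumberTheory.EllipticCurves.IwasawaAlgebra Literature.NumberTheory.EllipticCurves.Kato2004
  Literature.NumberTheory.EllipticCurves.Module

namespace Summit.BirchSwinnertonDyer.BirchSwinnertonDyer.Theorems.ChromaticCommonZeros

/-! ### §0 Plumbing: a free `Λ`-module of rank one is cyclic on a non-zero generator -/

section Cyclic

variable {R : Type*} [CommRing R] [Nontrivial R] {M : Type*} [AddCommGroup M] [Module R M]

/-- A free module of `finrank 1` over a non-trivial commutative ring has a non-zero cyclic generator (`M ≃ₗ R`,
`Module.nonempty_linearEquiv_of_finrank_eq_one`). Plumbing for Kato Thm. 12.4 (3). [folklore] -/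
theorem exists_generator_of_free_of_finrank_eq_one [Module.Free R M] (h : Module.finrank R M = 1) :
    ∃ m₀ : M, m₀ ≠ 0 ∧ ∀ m : M, ∃ r : R, r • m₀ = m := by
  obtain ⟨e⟩ := Module.nonempty_linearEquiv_of_finrank_eq_one h
  refine ⟨e 1, fun h0 => one_ne_zero (e.injective (by rw [h0, map_zero])), fun m => ⟨e.symm m, ?_⟩⟩
  rw [← map_smul, smul_eq_mul, mul_one, LinearEquiv.apply_symm_apply]

end Cyclic

/-! ### §1 (M1) for the natural-keyed (`γ⁻¹`) family from the typed Poitou–Tate functional model -/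

section Natural

/-- **(M1) «chromatic excess ≤ cotorsion» for the PRINT-KEYED family, from the typed Poitou–Tate input.** On class X8, in the
cyclotomic/Honda frame, for every natural-keyed (`γ⁻¹`) Pontryagin-dual data `S'` of `Sel_{p^∞}(E/ℚ_∞)`, `Ds', Df'` of `Sel♯, Sel♭` and
`Y'` of `Sel₀`, at every height-one `𝔭 ∌ p, T`: `min(ℓ_𝔭 Ds'.X, ℓ_𝔭 Df'.X) ≤ ℓ_𝔭 Y'.X + ℓ_𝔭(tors_Λ S'.X)`. Proof: Kato's `𝐇¹ = I.H`
exists (`nonempty_iwasawaH1Data`) and is free of rank one (`thm12_4` (3); `E[3]` irreducible on X8 by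
`hasIrreducibleModPGaloisRep_of_dvd_frobeniusTrace`), hence cyclic on some `h₀ ≠ 0`; the fact
`thm714seq_sharpFlat_poitouTate_functionalModel` supplies `loc` (injective, so `loc h₀ ≠ 0`), `toX` (exact), `πY`, `π♯`, `π♭` with
the printed kernels; w2's `min_lengthAt_le_fine_add_torsion_of_poitouTate_functionalModel` does the rest (joint Coleman map from the
tree). CONDITIONAL on the three named facts. [cite: Sprung2012, Thm. 7.14 proof with (3) (p. 1504), Def. 7.9, 7.11 (p. 1503), Def. 7.13 (p. 1504)]
[cite: Kobayashi2003, (7.16)–(7.20), Prop. 7.1, Thm. 7.3 i) (pp. 12–13)] [cite: Kato2004Asterisque, Thm. 12.4 (p. 221), §12.2 (p. 220)]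
[cite: KuriharaPollack2007, Prop. 1.2] [cite: Serre1972, §1.11 Prop. 12] -/
theorem massCotorsion_contraFamily_of_poitouTate (hPT : thm714seq_sharpFlat_poitouTate_functionalModel)
    (h124 : Kato2004.thm12_4) (hI : Kato2004.nonempty_iwasawaH1Data) :
    ∀ (W : WeierstrassCurve ℚ) [W.IsElliptic] [W.IsGloballyMinimal] (p : ℕ) [Fact p.Prime],
      ClassX8 W p → ∀ (κ : ZpExtension ℚ p) (γ : Field.absoluteGaloisGroup ℚ),
      κ.IsCyclotomic → κ.IsTopGenerator γ →
    ∀ (v : HeightOneSpectrum (𝓞 ℚ)), (p : 𝓞 ℚ) ∈ v.asIdeal →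
    ∀ (g : Field.absoluteGaloisGroup (v.adicCompletion ℚ)),
      κ.IsTopGenerator (resGalOfEmb (closureEmb (K := ℚ) (v.adicCompletion ℚ)) g) →
    ∀ (cneg : localPoints W (v.adicCompletion ℚ)) (c : ℕ → localPoints W (v.adicCompletion ℚ)),
      IsHondaSystem κ (closureEmb (K := ℚ) (v.adicCompletion ℚ)) W (W.frobeniusTrace p) g cneg c →
    ∀ (S' : W.SelmerDualData κ γ⁻¹)
      (Ds' : SharpFlatSelmerDualData W κ γ⁻¹ (closureEmb (K := ℚ) (v.adicCompletion ℚ)) (W.frobeniusTrace p) g c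
        Chroma.sharp)
      (Df' : SharpFlatSelmerDualData W κ γ⁻¹ (closureEmb (K := ℚ) (v.adicCompletion ℚ)) (W.frobeniusTrace p) g c
        Chroma.flat)
      (Y' : W.FineSelmerDualData κ γ⁻¹) (𝔭 : PrimeSpectrum (IwasawaAlgebra p)), 𝔭.asIdeal.height = 1 →
      (p : IwasawaAlgebra p) ∉ 𝔭.asIdeal → (PowerSeries.X : IwasawaAlgebra p) ∉ 𝔭.asIdeal →
      min (Module.lengthAt (IwasawaAlgebra p) Ds'.X 𝔭) (Module.lengthAt (IwasawaAlgebra p) Df'.X 𝔭) ≤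
        Module.lengthAt (IwasawaAlgebra p) Y'.X 𝔭 +
          Module.lengthAt (IwasawaAlgebra p) (Submodule.torsion (IwasawaAlgebra p) S'.X) 𝔭 := by
  intro W _ _ p _ hX κ γ hκ hγ v hv g hg cneg c hH S' Ds' Df' Y' 𝔭 h𝔭 _hp𝔭 hT𝔭
  obtain ⟨hp3, ⟨hgood, hap⟩, -⟩ := hX
  subst hp3
  have hp2 : (3 : ℕ) ≠ 2 := by decide
  have hirr : W.HasIrreducibleModPGaloisRep 3 :=
    hasIrreducibleModPGaloisRep_of_dvd_frobeniusTrace W 3 hp2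
      (W.not_dvd_minimalDiscriminantInt_of_hasGoodReductionAtPrime' 3 hgood) hap
  letI : ContinuousSMul ℤ_[3] (W.tateModule 3) := TateModule.continuousSMul_padicInt
  letI := moduleOfGenerator κ (closureEmb (K := ℚ) (v.adicCompletion ℚ)) W hg
  -- Kato's `𝐇¹`, free of rank one, cyclic on `h₀ ≠ 0`
  obtain ⟨I⟩ := hI W 3 κ γ hκ hγ
  obtain ⟨-, -, hfree⟩ := h124 W 3 κ γ hκ hγ I
  obtain ⟨hFree, hfr⟩ := hfree hp2 hirr
  haveI := hFree
  obtain ⟨h₀, h₀ne, hcyc⟩ := exists_generator_of_free_of_finrank_eq_one (R := IwasawaAlgebra 3) (M := I.H) hfr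
  -- the typed Poitou–Tate functional model
  obtain ⟨loc, toX, hinj, hexact, hY, hcol⟩ := hPT W 3 hp2 hgood hap κ γ hκ hγ v hv g hg cneg c hH I S'
  have hloc : loc h₀ ≠ 0 := fun h0 => h₀ne (hinj (by rw [h0, map_zero]))
  obtain ⟨πY, hπY, hkerY⟩ := hY Y'
  obtain ⟨πs, hπs, hkers⟩ := hcol Chroma.sharp Ds'
  obtain ⟨πf, hπf, hkerf⟩ := hcol Chroma.flat Df'
  exact min_lengthAt_le_fine_add_torsion_of_poitouTate_functionalModel W 3 hp2 hgood hap κ hv hg hH loc toX hexact πY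
    hπY hkerY πs hπs hkers πf hπf hkerf h₀ hcyc hloc 𝔭 h𝔭 hT𝔭

end Natural

/-! ### §2 (M1) for the tree-keyed (`γ`) family = `hM1` of `cokerBoundIotaOffT_of_cotorsion_of_matar` verbatim -/

section TreeKeyed

/-- **(M1) «`min(ℓ_𝔭 X♯, ℓ_𝔭 X♭) ≤ ℓ_𝔭 X₀ + ℓ_𝔭 tors_Λ X(E/ℚ_∞)`» for the tree's `γ`-keyed pinned duals on class X8, at every
height-one `𝔭 ∌ p, T`** — hypothesis `hM1` of `cokerBoundIotaOffT_of_cotorsion_of_matar` / `massIota_of_cotorsion_of_fine` VERBATIM,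
DISCHARGED modulo the named facts `thm714seq_sharpFlat_poitouTate_functionalModel`, `Kato2004.thm12_4`, `Kato2004.nonempty_iwasawaH1Data`:
§1 read at the mirror prime through w2's `massCotorsion_of_contraFamily` ((M1) is keying-immune).
[cite: Sprung2012, Thm. 7.14 proof with (3) (p. 1504)] [cite: Kobayashi2003, (7.18)–(7.20), Thm. 7.3 i) (pp. 12–13)]
[cite: Kato2004Asterisque, Thm. 12.4 (p. 221)] [cite: Greenberg1989, §0 pp. 101–102] -/
theorem massCotorsion_of_poitouTate (hPT : thm714seq_sharpFlat_poitouTate_functionalModel)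
    (h124 : Kato2004.thm12_4) (hI : Kato2004.nonempty_iwasawaH1Data) :
    ∀ (W : WeierstrassCurve ℚ) [W.IsElliptic] [W.IsGloballyMinimal] (p : ℕ) [Fact p.Prime],
      ClassX8 W p → ∀ (κ : ZpExtension ℚ p) (γ : Field.absoluteGaloisGroup ℚ),
      κ.IsCyclotomic → κ.IsTopGenerator γ →
    ∀ (v : HeightOneSpectrum (𝓞 ℚ)), (p : 𝓞 ℚ) ∈ v.asIdeal →
    ∀ (g : Field.absoluteGaloisGroup (v.adicCompletion ℚ)),
      κ.IsTopGenerator (resGalOfEmb (closureEmb (K := ℚ) (v.adicCompletion ℚ)) g) →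
    ∀ (cneg : localPoints W (v.adicCompletion ℚ)) (c : ℕ → localPoints W (v.adicCompletion ℚ)),
      IsHondaSystem κ (closureEmb (K := ℚ) (v.adicCompletion ℚ)) W (W.frobeniusTrace p) g cneg c →
    ∀ (S : W.SelmerDualData κ γ)
      (Ds : SharpFlatSelmerDualData W κ γ (closureEmb (K := ℚ) (v.adicCompletion ℚ)) (W.frobeniusTrace p) g c
        Chroma.sharp)
      (Df : SharpFlatSelmerDualData W κ γ (closureEmb (K := ℚ) (v.adicCompletion ℚ)) (W.frobeniusTrace p) g c
        Chroma.flat)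
      (Y : W.FineSelmerDualData κ γ) (𝔭 : PrimeSpectrum (IwasawaAlgebra p)), 𝔭.asIdeal.height = 1 →
      (p : IwasawaAlgebra p) ∉ 𝔭.asIdeal → (PowerSeries.X : IwasawaAlgebra p) ∉ 𝔭.asIdeal →
      min (Module.lengthAt (IwasawaAlgebra p) Ds.X 𝔭) (Module.lengthAt (IwasawaAlgebra p) Df.X 𝔭) ≤
        Module.lengthAt (IwasawaAlgebra p) Y.X 𝔭 +
          Module.lengthAt (IwasawaAlgebra p) (Submodule.torsion (IwasawaAlgebra p) S.X) 𝔭 :=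
  massCotorsion_of_contraFamily (massCotorsion_contraFamily_of_poitouTate hPT h124 hI)

end TreeKeyed

/-! ### §3 THE REGISTERED STUB F-α♮ modulo named printed facts only -/

section Stub

/-- **F-α♮ — the registered stub `IotaDoor.stub_cokerBoundIotaOffT` (children 22569 / 22901 / 22570 / 23112 of crux
`SprungLowerDivisibilityAtThree`), ITS SIGNATURE VERBATIM, with NO displayed hypothesis, modulo five NAMED printed facts:**
`thm714seq_sharpFlat_poitouTate_functionalModel` (Sprung 2012 Thm. 7.14 proof, (7.18)_∞ + (3); Kobayashi 2003 (7.16)–(7.20), Thm. 7.3 i)),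
`Kato2004.thm12_4` (Thm. 12.4 (3)), `Kato2004.nonempty_iwasawaH1Data` ((12.2.1)), `matar2020_thm11_selmerDualTorsion_pseudoIso_fineSelmerDual`
(Matar 2020 Thm. 1.1 = Wingberg 1989 Cor. 2.5), `Kato2004_fineSelmerDual_isTorsion` (Kato Thm. 12.4 (1) / Kobayashi Cor. 7.2). Composition:
`cokerBoundIotaOffT_of_cotorsion_of_matar (massCotorsion_of_poitouTate …)` — i.e. (SES-KP) (tree, w2 g8) + Poitou–Tate (typed) + Kato
12.4 + Wingberg/Matar, exactly the printed derivation recorded in the stub's docstring. So the LEAD may write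
`stub_cokerBoundIotaOffT := cokerBoundIotaOffT_of_poitouTate hPT h124 hI hMatar hfine` behind fact binders.
[cite: Sprung2012, Thm. 7.14 proof with (3) (p. 1504), §7.1 Props. 7.3/7.6 (pp. 1500–1501), Prop. 7.19 (p. 1505)]
[cite: Kobayashi2003, (7.16)–(7.20), Prop. 7.1, Thm. 7.3 (pp. 12–13)] [cite: Kato2004Asterisque, Thm. 12.4 (p. 221), (17.13.1) (p. 279)]
[cite: KuriharaPollack2007, Prop. 1.2] [cite: LeiSujatha2021, (SES-KP), (PT)] [cite: Wingberg1989, Cor. 2.5] [cite: Matar2020, Thm. 1.1] -/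
theorem cokerBoundIotaOffT_of_poitouTate (hPT : thm714seq_sharpFlat_poitouTate_functionalModel)
    (h124 : Kato2004.thm12_4) (hI : Kato2004.nonempty_iwasawaH1Data)
    (hMatar : matar2020_thm11_selmerDualTorsion_pseudoIso_fineSelmerDual)
    (hfine : Kato2004_fineSelmerDual_isTorsion) :
    ∀ (W : WeierstrassCurve ℚ) [W.IsElliptic] [W.IsGloballyMinimal] (p : ℕ) [Fact p.Prime]
      [ContinuousSMul ℤ_[p] (W.tateModule p)] [Module.Free ℤ_[p] (W.tateModule p)]
      [Module.Finite ℤ_[p] (W.tateModule p)],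
      ClassX8 W p → ∀ (κ : ZpExtension ℚ p) (γ : Field.absoluteGaloisGroup ℚ),
      κ.IsCyclotomic → κ.IsTopGenerator γ → IsCyclotomicVariable p γ →
    ∀ (v : HeightOneSpectrum (𝓞 ℚ)), (p : 𝓞 ℚ) ∈ v.asIdeal →
    ∀ (g : Field.absoluteGaloisGroup (v.adicCompletion ℚ)),
      κ.IsTopGenerator (resGalOfEmb (closureEmb (K := ℚ) (v.adicCompletion ℚ)) g) →
    ∀ (cneg : localPoints W (v.adicCompletion ℚ)) (c : ℕ → localPoints W (v.adicCompletion ℚ)),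
      IsHondaSystem κ (closureEmb (K := ℚ) (v.adicCompletion ℚ)) W (W.frobeniusTrace p) g cneg c →
    ∀ (N : ℕ) (_ : NeZero N) (f : CuspForm (Gamma0 N) 2) (ϖ : ℚ) (Lsharp Lflat : IwasawaAlgebra p),
      IsNewformOf W f → (ϖ : ℝ) * W.realPeriodRat = plusPeriod f →
      IsSprungPair f p (W.frobeniusTrace p) Lsharp Lflat →
    ∀ (I : Kato2004.IwasawaH1Data W p κ γ)
      (Cs : SharpFlatColemanKatoData W p f ϖ κ γ (closureEmb (K := ℚ) (v.adicCompletion ℚ))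
        (W.frobeniusTrace p) g c Chroma.sharp I)
      (Cf : SharpFlatColemanKatoData W p f ϖ κ γ (closureEmb (K := ℚ) (v.adicCompletion ℚ))
        (W.frobeniusTrace p) g c Chroma.flat I),
      Cs.Z = Cf.Z →
    ∀ (Y : W.FineSelmerDualData κ γ) (𝔭 : PrimeSpectrum (IwasawaAlgebra p)), 𝔭.asIdeal.height = 1 →
      (p : IwasawaAlgebra p) ∉ 𝔭.asIdeal → (PowerSeries.X : IwasawaAlgebra p) ∉ 𝔭.asIdeal →
      (∀ (col' : Chroma) (G' : IwasawaAlgebra p),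
        iwasawaToPowerSeries p G' =
          PowerSeries.C (ϖ : ℚ_[p]) * iwasawaToPowerSeries p (chromaticL col' Lsharp Lflat) →
        G' ∈ 𝔭.asIdeal) →
      min (Module.lengthAt (IwasawaAlgebra p) (IwasawaAlgebra p ⧸ LinearMap.range Cs.colMap) 𝔭)
          (Module.lengthAt (IwasawaAlgebra p) (IwasawaAlgebra p ⧸ LinearMap.range Cf.colMap) 𝔭) ≤
        Module.lengthAt (IwasawaAlgebra p) Y.X (PrimeSpectrum.comap (invol p).toRingHom 𝔭) :=
  cokerBoundIotaOffT_of_cotorsion_of_matar (massCotorsion_of_poitouTate hPT h124 hI) hMatar hfine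

end Stub

end Summit.BirchSwinnertonDyer.BirchSwinnertonDyer.Theorems.ChromaticCommonZeros

end
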